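import Summits.FinalStateConjecture.FinalStateConjecture.Theses.RenormalisedDrift
import Literature.Geometry.Lorentzian.TameGenericityLocal

/-!
# Birth skeleton (BC3) for crux `AdiabaticTracking` — route `RenormalisedDrift`
# "censorship curves; land the censoring curve in the tracked regime; escape the untracked walls inside the censored class"

Skeleton registrar `planner-skel-stmt-FinalStateConjecture-17504-0`, 2026-08-17 (route re-audit bin REPAIRABLE;
BC3 of `run/shared/lean/lens3/_common/BC.md`). Published as `Cruxes/AdiabaticTracking/Lines/birth.lean`.

TARGET (FIXED, concluded BY NAME): the route decl
`Summit.FinalStateConjecture.FinalStateConjecture.Theses.RenormalisedDrift.AdiabaticTracking`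
(item stmt-FinalStateConjecture-17504, rev 5/6 of the route file; crux, rank 3, the route's FRONT END).

THE CRUX. For every connected Hausdorff second-countable smooth `3`-manifold `X`, TAME-Christodoulou-generically
(codimension `1`; ONE tame, immersed, injective witness curve on ONE fixed end per exceptional datum) in
`admissibleVacuumData X`, the property
`Good D := (∃ MGHD) ∧ ∀ MGHD 𝒟, complete 𝓘⁺ ∧ ∃ (N, m₀ > 0, 0 ≤ χ < 1) ∀ (L > 0, ε > 0, R₀), 𝒟.IsAdiabaticallyTracked N m₀ χ ε L R₀`
— an MGHD exists, and every MGHD is censored and ADIABATICALLY TRACKED AT EVERY ACCURACY with one complexity `(N, m₀, χ)`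
(window-by-window `C²`-closeness to the moduli space of receding sub-extremal `N`-Kerr configurations, parameters free
to migrate between windows; `Literature/Geometry/Lorentzian/AdiabaticTracking.lean`). Content: weak cosmic censorship
+ "no eternal non-Kerr vacuum dynamics / finitely many mergers / a generic third-law margin", bundled into ONE generic
statement because tame genericity is not closed under `∧` (route header, RANKED CRUXES #3).

## The cut (four named stubs; none is the crux, none is the summit)

Tame codimension-1 genericity is NOT closed under conjunction of properties (the witness curve leaving one exceptional
set may run inside the other), so the crux cannot be split into generic pieces by logic. The landed kernels
`InitialDataSet.isTameChristodoulouGeneric_of_local`, `InitialDataSet.exists_tameCurve_of_local`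
(TameGenericityLocal.lean: avoidance for `0 < ‖c‖ < ε` suffices, by radial reparametrisation) and
`InitialDataSet.IsTameChristodoulouGeneric.mono` (TameGenericityDiagonal.lean) say how a generic HYPOTHESIS enters a
generic CONCLUSION: along its witness curves, exceptional base datum by exceptional base datum. An exceptional datum
`d` of the crux either has NO MGHD (impossible: S0), or is VIOLATING (some MGHD has incomplete `𝓘⁺`), or is CENSORED
but has an untracked MGHD; hence — the same cut as the registered skeleton `Cruxes/GenericLegs/Lines/birth.lean`
of the sibling crux `MergerLatticeBudget.GenericLegs`, with "sub-extremality margin on leaves" replaced by "adiabatic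
tracking at every accuracy":

* `stub_mghdExists` (S0, known theorem, XL formalisation) — every admissible datum has an MGHD (Choquet-Bruhat–Geroch
  1969 Thm 3; Sbierski 2016 Thm 2.6). VERBATIM the route's shared support item `MGHDExists`
  (stmt-FinalStateConjecture-9937; `mghdExists_iff` below is `Iff.rfl`), i.e. the rung the route header names
  (`adiabaticTracking_of_pure : MGHDExists → AdiabaticTrackingPure → AdiabaticTracking`): it discharges the
  anti-vacuity conjunct `∃ MGHD` POINTWISE, the one conjunct of `Good` that is a printed theorem.
* `stub_weakCosmicCensorship` (S1, open problem, XL) — WEAK COSMIC CENSORSHIP, tame positive-codimension form, local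
  in the parameter: through every violating admissible datum passes a tame, immersed, injective curve of admissible
  data whose small members are censored. VERBATIM (as an elaborated type) the stub of the same name in
  `Cruxes/GenericLegs/Lines/birth.lean`, `Cruxes/CensorshipViolationCodim/Lines/birth.lean`,
  `Cruxes/GenericCensoredHolesSettle/…` — one proof serves every front end of the summit.
* `stub_trackedLandingAlongCensoredCurves` (S2, open problem, L–XL) — LANDING IN THE TRACKED REGIME ALONG CENSORED
  CURVES (relative form): given a tame immersed injective admissible curve with VIOLATING base datum whose members
  off `0` are censored, there is (on some end) a tame immersed injective admissible curve through the same base datum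
  whose small members are censored AND adiabatically tracked at every accuracy. Content: the black holes / dispersal
  produced by censoring (trapped-surface-forming) perturbations of a naked singularity can be steered into the
  asymptotically stable sub-extremal multi-Kerr regime — the censoring escape lands in the basin, with a margin.
* `stub_trackingEscapeInsideCensored` (S3, open problem, XL; THE HARDEST) — ESCAPE FROM THE UNTRACKED WALLS INSIDE THE
  CENSORED CLASS: through every CENSORED admissible datum one of whose MGHDs is NOT tracked at every accuracy with
  one `(N, m₀, χ < 1)` (exactly / asymptotically extremal final horizons, endless merger cascades, eternal non-Kerr
  dynamics, `C²`-untrackable tails) passes a tame immersed injective admissible curve whose small members are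
  censored and tracked. Content: inside the censored class the untracked data form walls of positive TAME
  codimension that can be left WHILE STAYING CENSORED (generic third law: Kehle–Unger's extremal critical collapse is
  a codimension-one threshold; "no breathers": Alexakis–Schlue / Bičák–Scholtz–Tod time-periodic rigidity; large-data
  asymptotic-orbital stability of the Kerr moduli space, Klainerman 2025 §2.3).

COMPOSITION `AdiabaticTracking_of` (kernel-checked, no `sorry` of its own, 20 lines): by S0 pointwise, tame genericity of
`Pure D := ∀ MGHD, complete 𝓘⁺ ∧ tracked` suffices (`mono`); local witnesses suffice (`isTameChristodoulouGeneric_of_local`);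
through an exceptional datum `d`: censored ⇒ S3; violating ⇒ S1 gives a locally censoring curve,
`exists_tameCurve_of_local` makes it censoring at every `c ≠ 0`, S2 lands it. The seam is a case split on the base datum
plus the tree's reparametrisation theorem; S1–S3 are strict WEAKENINGS of the crux (§4, sorry-free: the crux implies
each), S0 is a printed theorem, and no stub alone — indeed no three of them — gives the crux or the summit by the
cheap probes (BC3 probe log in `Lines/birth.md`: 8/8 FAIL).

Disproof used: none exists for this crux (`ledger crux ls stmt-FinalStateConjecture-17504`: no workfiles, no
`Disproof.lean`, hence no `_false_without_` obligations); negatives index (`ledger negatives --problem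
FinalStateConjecture`, 2026-08-17): one unrelated refutation (`not_UniformPhotonSphereChannels`, an ODE statement on
photon-sphere channels) — no stub restates it. The rev-0 quantifier-order witness against `DriftCapture` (one accuracy
chosen before the data) does not bear on this crux, whose accuracy quantifiers are `∃ (N,m₀,χ) ∀ (L,ε,R₀)` per MGHD,
kept verbatim in S2/S3.
-/

noncomputable section

-- D-0017: the doubled `FinalStateConjecture.FinalStateConjecture` path component trips dupNamespace
set_option linter.dupNamespace false

namespace Summit.FinalStateConjecture.FinalStateConjecture.Cruxes.AdiabaticTracking.Birth

open scoped BigOperators Topology Manifold Classical ContDiff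
open Filter Set Function TopologicalSpace
open Literature.Geometry.Lorentzian
open Summit.FinalStateConjecture.FinalStateConjecture.Theses.RenormalisedDrift (AdiabaticTracking MGHDExists)

/-! ## §1 Vocabulary of the line (reducible abbreviations for the composition proof ONLY — no stub signature uses
them; every stub is stated over the Statement + Literature prelude) -/

section Vocabulary

variable {X : Type} [TopologicalSpace X] [ChartedSpace E3 X] [IsManifold (𝓡 3) ((⊤ : ℕ∞) : WithTop ℕ∞) X]
  [ConnectedSpace X]

/-- `D` is **censored**: every MGHD of `D` has complete future null infinity (sojourn form). [folklore] -/
abbrev Censored (D : InitialDataSet (𝓡 3) X) : Prop :=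
  ∀ 𝒟 : VacuumCauchyDevelopment D, 𝒟.IsMaximal →
    Summit.FinalStateConjecture.HasCompleteNullInfinity 𝒟.toCauchyDevelopment

/-- The MGHD `𝒟` is **adiabatically tracked at every accuracy with one complexity** (the crux's tracking clause,
verbatim). [folklore] -/
abbrev TrackedDev {D : InitialDataSet (𝓡 3) X} (𝒟 : VacuumCauchyDevelopment D) : Prop :=
  ∃ (N : ℕ) (m₀ χ : ℝ), 0 < m₀ ∧ 0 ≤ χ ∧ χ < 1 ∧ ∀ (L : ℝ) (ε : ENNReal) (R₀ : ℝ), 0 < L → 0 < ε →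
    𝒟.IsAdiabaticallyTracked N m₀ χ ε L R₀

/-- **The pure property** `Pure D`: every MGHD censored and tracked (the crux's property without the anti-vacuity
conjunct). [folklore] -/
abbrev Pure (D : InitialDataSet (𝓡 3) X) : Prop :=
  ∀ 𝒟 : VacuumCauchyDevelopment D, 𝒟.IsMaximal →
    Summit.FinalStateConjecture.HasCompleteNullInfinity 𝒟.toCauchyDevelopment ∧ TrackedDev 𝒟

/-- **The crux's property** `Good D` (verbatim the lambda of `AdiabaticTracking`): an MGHD exists, and `Pure D`.
[folklore] -/
abbrev Good (D : InitialDataSet (𝓡 3) X) : Prop :=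
  (∃ 𝒟 : VacuumCauchyDevelopment D, 𝒟.IsMaximal) ∧
    ∀ 𝒟 : VacuumCauchyDevelopment D, 𝒟.IsMaximal →
      Summit.FinalStateConjecture.HasCompleteNullInfinity 𝒟.toCauchyDevelopment ∧
        ∃ (N : ℕ) (m₀ χ : ℝ), 0 < m₀ ∧ 0 ≤ χ ∧ χ < 1 ∧ ∀ (L : ℝ) (ε : ENNReal) (R₀ : ℝ), 0 < L → 0 < ε →
          𝒟.IsAdiabaticallyTracked N m₀ χ ε L R₀

end Vocabulary

/-- The filed crux displayed over the vocabulary — definitional unfolding only (`Iff.rfl`), the guard that §1 is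
byte-faithful to the route file. [folklore] -/
theorem adiabaticTracking_iff :
    AdiabaticTracking ↔
      ∀ (X : Type) [TopologicalSpace X] [ChartedSpace E3 X] [IsManifold (𝓡 3) ((⊤ : ℕ∞) : WithTop ℕ∞) X]
        [T2Space X] [SecondCountableTopology X] [ConnectedSpace X],
        InitialDataSet.IsTameChristodoulouGeneric (admissibleVacuumData X) Good 1 :=
  Iff.rfl

/-! ## §2 The four stubs (the ONLY `sorry`s of this file), stated expanded over existing declarations -/

/-! ### Statements under the stub names (the A12 audit reads the hypotheses of `AdiabaticTracking_of` by the HEAD NAME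
of their types: each head below is a declared stub name). -/
namespace Goal

/-- Statement of `stub_mghdExists` (S0). -/
abbrev stub_mghdExists : Prop :=
  ∀ (X : Type) [TopologicalSpace X] [ChartedSpace E3 X] [IsManifold (𝓡 3) ((⊤ : ℕ∞) : WithTop ℕ∞) X] [T2Space X] [SecondCountableTopology X] [ConnectedSpace X], ∀ D ∈ admissibleVacuumData X, ∃ 𝒟 : VacuumCauchyDevelopment D, 𝒟.IsMaximal

/-- Statement of `stub_weakCosmicCensorship` (S1). -/
abbrev stub_weakCosmicCensorship : Prop :=
  ∀ (X : Type) [TopologicalSpace X] [ChartedSpace E3 X] [IsManifold (𝓡 3) ((⊤ : ℕ∞) : WithTop ℕ∞) X] [T2Space X] [SecondCountableTopology X] [ConnectedSpace X], ∀ D ∈ admissibleVacuumData X, (∃ 𝒟 : VacuumCauchyDevelopment D, 𝒟.IsMaximal ∧ ¬ Summit.FinalStateConjecture.HasCompleteNullInfinity 𝒟.toCauchyDevelopment) → ∃ (e : AFEnd X) (F : EuclideanSpace ℝ (Fin 1) → InitialDataSet (𝓡 3) X), InitialDataSet.IsTameDataFamily e 1 F ∧ InitialDataSet.IsImmersedAtZero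 1 F ∧ F 0 = D ∧ Function.Injective F ∧ (∀ c, F c ∈ admissibleVacuumData X) ∧ ∃ ε > (0 : ℝ), ∀ c, c ≠ 0 → ‖c‖ < ε → ∀ 𝒟 : VacuumCauchyDevelopment (F c), 𝒟.IsMaximal → Summit.FinalStateConjecture.HasCompleteNullInfinity 𝒟.toCauchyDevelopment

/-- Statement of `stub_trackedLandingAlongCensoredCurves` (S2). -/
abbrev stub_trackedLandingAlongCensoredCurves : Prop :=
  ∀ (X : Type) [TopologicalSpace X] [ChartedSpace E3 X] [IsManifold (𝓡 3) ((⊤ : ℕ∞) : WithTop ℕ∞) X] [T2Space X] [SecondCountableTopology X] [ConnectedSpace X], ∀ (e : AFEnd X) (F : EuclideanSpace ℝ (Fin 1) → InitialDataSet (𝓡 3) X), InitialDataSet.IsTameDataFamily e 1 F → InitialDataSet.IsImmersedAtZero 1 F → Function.Injective F → (∀ c, F c ∈ admissibleVacuumData X) → (∃ 𝒟 : VacuumCauchyDevelopment (F 0), 𝒟.IsMaximal ∧ ¬ Summit.FinalStateConjecture.HasCompleteNullInfinity 𝒟.toCauchyDevelopment) → (∀ c ≠ 0, ∀ 𝒟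 : VacuumCauchyDevelopment (F c), 𝒟.IsMaximal → Summit.FinalStateConjecture.HasCompleteNullInfinity 𝒟.toCauchyDevelopment) → ∃ (e' : AFEnd X) (F' : EuclideanSpace ℝ (Fin 1) → InitialDataSet (𝓡 3) X), InitialDataSet.IsTameDataFamily e' 1 F' ∧ InitialDataSet.IsImmersedAtZero 1 F' ∧ F' 0 = F 0 ∧ Function.Injective F' ∧ (∀ c, F' c ∈ admissibleVacuumData X) ∧ ∃ δ > (0 : ℝ), ∀ c, c ≠ 0 → ‖c‖ < δ → ∀ 𝒟 : VacuumCauchyDevelopment (F' c), 𝒟.IsMaximal → Summit.FinalStateConjecture.HasCompleteNullInfinity 𝒟.toCauchyDevelopment ∧ ∃ (N : ℕ) (m₀ χ : ℝ), 0 < m₀ ∧ 0 ≤ χ ∧ χ < 1 ∧ ∀ (L : ℝ) (ε : ENNReal) (R₀ : ℝ), 0 < L → 0 < ε → 𝒟.IsAdiabaticallyTracked N m₀ χ ε L R₀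

/-- Statement of `stub_trackingEscapeInsideCensored` (S3). -/
abbrev stub_trackingEscapeInsideCensored : Prop :=
  ∀ (X : Type) [TopologicalSpace X] [ChartedSpace E3 X] [IsManifold (𝓡 3) ((⊤ : ℕ∞) : WithTop ℕ∞) X] [T2Space X] [SecondCountableTopology X] [ConnectedSpace X], ∀ D ∈ admissibleVacuumData X, (∀ 𝒟 : VacuumCauchyDevelopment D, 𝒟.IsMaximal → Summit.FinalStateConjecture.HasCompleteNullInfinity 𝒟.toCauchyDevelopment) → ¬ (∀ 𝒟 : VacuumCauchyDevelopment D, 𝒟.IsMaximal → Summit.FinalStateConjecture.HasCompleteNullInfinity 𝒟.toCauchyDevelopment ∧ ∃ (N : ℕ) (m₀ χ : ℝ), 0 < m₀ ∧ 0 ≤ χ ∧ χ < 1 ∧ ∀ (L : ℝ) (ε : ENNReal) (R₀ : ℝ), 0 < L → 0 < ε → 𝒟.IsAdiabaticallyTracked N m₀ χ ε L R₀) → ∃ (e : AFEnd X) (F : EuclideanSpace ℝ (Fin 1) → InitialDataSet (𝓡 3) X), InitialDataSet.IsTameDataFamily e 1 F ∧ InitialDataSet.IsImmersedAtZero 1 F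 ∧ F 0 = D ∧ Function.Injective F ∧ (∀ c, F c ∈ admissibleVacuumData X) ∧ ∃ δ > (0 : ℝ), ∀ c, c ≠ 0 → ‖c‖ < δ → ∀ 𝒟 : VacuumCauchyDevelopment (F c), 𝒟.IsMaximal → Summit.FinalStateConjecture.HasCompleteNullInfinity 𝒟.toCauchyDevelopment ∧ ∃ (N : ℕ) (m₀ χ : ℝ), 0 < m₀ ∧ 0 ≤ χ ∧ χ < 1 ∧ ∀ (L : ℝ) (ε : ENNReal) (R₀ : ℝ), 0 < L → 0 < ε → 𝒟.IsAdiabaticallyTracked N m₀ χ ε L R₀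

end Goal

/-- **Stub S0 — MGHD existence for all admissible data (the anti-vacuity conjunct; Choquet-Bruhat–Geroch 1969,
Thm. 3; Sbierski 2016, Thm. 2.6).** For every connected Hausdorff second-countable `3`-manifold `X` and every datum of
Christodoulou's admissible class there is a maximal vacuum Cauchy development. Verbatim the route's support item
`MGHDExists` (stmt-FinalStateConjecture-9937, shared by every route of the summit; `mghdExists_iff`); closable,
conditionally on the named fact, by `fun X _ _ _ _ _ _ ↦ h.forall_mem_admissibleVacuumData X` from
`Literature.Geometry.Lorentzian.choquetBruhat_geroch_exists_mghd_cauchy` (AdmissibleMGHDExistence.lean). Why a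
separate stub: the crux asserts `∃ MGHD` only generically, but it holds pointwise and is the one conjunct that is a
printed theorem. Why it might fail: it does not (only a mismatch between the prelude's `VacuumCauchyDevelopment.IsMaximal`
and the printed notion could bite). [cite: ChoquetBruhatGeroch1969CMP, Thm. 3] [cite: Sbierski2016AHP, Thm. 2.6] -/
theorem stub_mghdExists :
    ∀ (X : Type) [TopologicalSpace X] [ChartedSpace E3 X] [IsManifold (𝓡 3) ((⊤ : ℕ∞) : WithTop ℕ∞) X] [T2Space X] [SecondCountableTopology X] [ConnectedSpace X], ∀ D ∈ admissibleVacuumData X, ∃ 𝒟 : VacuumCauchyDevelopment D, 𝒟.IsMaximal := by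
  sorry

/-- **Stub S1 — weak cosmic censorship, tame positive-codimension form, local in the parameter** (XL, open problem).
Through every admissible vacuum datum possessing an MGHD with INCOMPLETE `𝓘⁺` pass one asymptotically flat end `e`, a
one-parameter family `F` of admissible data tame on `e`, immersed at `0`, `F 0 = D`, injective, and `ε > 0` such that
for `0 < ‖c‖ < ε` every MGHD of `F c` has complete `𝓘⁺`. Christodoulou, CQG 16 (1999) A23, p. A24 (proved for the
spherically symmetric scalar field, Ann. Math. 149 (1999) 183, Thm. p. 187); Dafermos–Rodnianski arXiv:0811.0354
§2.6.2. Verbatim the stub of the same name registered for the sibling cruxes `GenericLegs`,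
`CensorshipViolationCodim`, `GenericCensoredHolesSettle` (one proof serves all). Why it might fail: the
exterior-naked-singularity vacuum solutions of Rodnianski–Shlapentokh-Rothman (arXiv:1912.08478) could be stable under
admissible perturbations at FIXED asymptotics; trapped-surface-formation instability is known only in symmetry / for
the scalar field. [cite: Christodoulou1999, p. A24] [cite: arXiv08110354, §2.6.2] -/
theorem stub_weakCosmicCensorship :
    ∀ (X : Type) [TopologicalSpace X] [ChartedSpace E3 X] [IsManifold (𝓡 3) ((⊤ : ℕ∞) : WithTop ℕ∞) X] [T2Space X] [SecondCountableTopology X] [ConnectedSpace X], ∀ D ∈ admissibleVacuumData X, (∃ 𝒟 : VacuumCauchyDevelopment D, 𝒟.IsMaximal ∧ ¬ Summit.FinalStateConjecture.HasCompleteNullInfinity 𝒟.toCauchyDevelopment) → ∃ (e : AFEnd X) (F : EuclideanSpace ℝ (Fin 1) → InitialDataSet (𝓡 3) X), InitialDataSet.IsTameDataFamily e 1 F ∧ InitialDataSet.IsImmersedAtZero 1 F ∧ F 0 = D ∧ Function.Injective F ∧ (∀ c, F c ∈ admissibleVacuumData X) ∧ ∃ ε > (0 : ℝ), ∀ c, c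 ≠ 0 → ‖c‖ < ε → ∀ 𝒟 : VacuumCauchyDevelopment (F c), 𝒟.IsMaximal → Summit.FinalStateConjecture.HasCompleteNullInfinity 𝒟.toCauchyDevelopment := by
  sorry

/-- **Stub S2 — landing in the tracked regime along censored curves** (L–XL, open problem; relative form). For every
end `e` and every tame (on `e`), immersed-at-`0`, injective curve `F` of admissible data whose base datum `F 0` has an
MGHD with INCOMPLETE `𝓘⁺` and whose members off `0` are censored, there are an end `e'`, a tame immersed injective
curve `F'` of admissible data, `F' 0 = F 0`, and `δ > 0` such that for `0 < ‖c‖ < δ` every MGHD of `F' c` has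
complete `𝓘⁺` AND is adiabatically tracked at every accuracy with one complexity: `∃ (N, m₀ > 0, 0 ≤ χ < 1)
∀ (L > 0, ε > 0, R₀), IsAdiabaticallyTracked N m₀ χ ε L R₀`. Content: the censoring escape from a
naked-singularity datum can be steered into the basin of the sub-extremal multi-Kerr moduli space — the black holes
(or dispersal) formed by trapped-surface-forming perturbations are finitely many, strictly sub-extremal with a margin,
and tracked window by window at every `C²` accuracy (Christodoulou's instability mechanism, CQG 16 p. A24, followed by
large-data asymptotic-orbital stability, Klainerman, C. R. Mécanique 353 (2025) §2.3; near-Kerr epochs by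
Klainerman–Szeftel / Giorgi–Klainerman–Szeftel). Why it might fail: every censoring curve through a violating datum
may run inside, or accumulate at `c → 0` on, an untracked wall — extremal critical collapse (Kehle–Unger
arXiv:2402.10190 §1.4.5) or arbitrarily long merger cascades seeded by the collapsing region; no large-data mechanism
producing a uniform `(N, m₀, χ)` along a curve is known. [cite: Christodoulou1999, p. A24] [cite: KehleUnger2025]
[cite: Klainerman2025, §2.3] -/
theorem stub_trackedLandingAlongCensoredCurves :
    ∀ (X : Type) [TopologicalSpace X] [ChartedSpace E3 X] [IsManifold (𝓡 3) ((⊤ : ℕ∞) : WithTop ℕ∞) X] [T2Space X] [SecondCountableTopology X] [ConnectedSpace X], ∀ (e : AFEnd X) (F : EuclideanSpace ℝ (Fin 1) → InitialDataSet (𝓡 3) X), InitialDataSet.IsTameDataFamily e 1 F → InitialDataSet.IsImmersedAtZero 1 F → Function.Injective F → (∀ c, F c ∈ admissibleVacuumData X) → (∃ 𝒟 : VacuumCauchyDevelopment (F 0), 𝒟.IsMaximal ∧ ¬ Summit.FinalStateConjecture.HasCompleteNullInfinity 𝒟.toCauchyDevelopment) → (∀ c ≠ 0, ∀ 𝒟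 : VacuumCauchyDevelopment (F c), 𝒟.IsMaximal → Summit.FinalStateConjecture.HasCompleteNullInfinity 𝒟.toCauchyDevelopment) → ∃ (e' : AFEnd X) (F' : EuclideanSpace ℝ (Fin 1) → InitialDataSet (𝓡 3) X), InitialDataSet.IsTameDataFamily e' 1 F' ∧ InitialDataSet.IsImmersedAtZero 1 F' ∧ F' 0 = F 0 ∧ Function.Injective F' ∧ (∀ c, F' c ∈ admissibleVacuumData X) ∧ ∃ δ > (0 : ℝ), ∀ c, c ≠ 0 → ‖c‖ < δ → ∀ 𝒟 : VacuumCauchyDevelopment (F' c), 𝒟.IsMaximal → Summit.FinalStateConjecture.HasCompleteNullInfinity 𝒟.toCauchyDevelopment ∧ ∃ (N : ℕ) (m₀ χ : ℝ), 0 < m₀ ∧ 0 ≤ χ ∧ χ < 1 ∧ ∀ (L : ℝ) (ε : ENNReal) (R₀ : ℝ), 0 < L → 0 < ε → 𝒟.IsAdiabaticallyTracked N m₀ χ ε L R₀ := by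
  sorry

/-- **Stub S3 — escape from the untracked walls inside the censored class** (XL, open problem; the hardest stub).
Through every CENSORED admissible datum `D` (all MGHDs have complete `𝓘⁺`) one of whose MGHDs is NOT adiabatically
tracked at every accuracy with one complexity `(N, m₀ > 0, χ < 1)` pass one end `e`, a tame immersed injective curve
`F` of admissible data, `F 0 = D`, and `δ > 0` such that for `0 < ‖c‖ < δ` every MGHD of `F c` is censored AND
tracked. Content: inside the censored class, the untracked data — exactly or asymptotically extremal final horizons
(no `χ < 1`), endless merger cascades (no `N`), evaporating mass floors (no `m₀`), eternal non-Kerr vacuum dynamics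
(breathers, perpetual wide binaries), `C²`-untrackable `i⁰` tails — form walls of positive TAME codimension which one
can leave along a tame curve WHILE STAYING CENSORED. Evidence: extremal critical collapse is a codimension-one
threshold in the Kehle–Unger models (arXiv:2211.15742; arXiv:2402.10190 §1.4.5); time-periodic asymptotically flat
vacuum solutions are rigid (Alexakis–Schlue arXiv:1504.04592; Bičák–Scholtz–Tod); asymptotic ORBITAL stability along
the Kerr family is the expected large-data behaviour (Klainerman, C. R. Mécanique 353 (2025) §2.3; Dafermos–Luk
arXiv:1710.01722 §1.2.1). Why it might fail: the extremal threshold need not be a tame hypersurface (one-sided or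
Cantor accumulation along every admissible curve through `D`); `C²`-quiet asymptotically extremal hairy horizons
(Aretakis; Gajic arXiv:2302.06636) or intermediate exactly-extremal epochs may be unavoidable along every censored
curve; an infinite cascade of ever smaller holes is not excluded pointwise by any known theorem. [cite: KehleUnger2025]
[cite: DafermosLuk2017, §1.2.1] [cite: Klainerman2025, §2.3] [cite: AlexakisSchlue2018] -/
theorem stub_trackingEscapeInsideCensored :
    ∀ (X : Type) [TopologicalSpace X] [ChartedSpace E3 X] [IsManifold (𝓡 3) ((⊤ : ℕ∞) : WithTop ℕ∞) X] [T2Space X] [SecondCountableTopology X] [ConnectedSpace X], ∀ D ∈ admissibleVacuumData X, (∀ 𝒟 : VacuumCauchyDevelopment D, 𝒟.IsMaximal → Summit.FinalStateConjecture.HasCompleteNullInfinity 𝒟.toCauchyDevelopment) → ¬ (∀ 𝒟 : VacuumCauchyDevelopment D, 𝒟.IsMaximal → Summit.FinalStateConjecture.HasCompleteNullInfinity 𝒟.toCauchyDevelopment ∧ ∃ (N : ℕ) (m₀ χ : ℝ), 0 < m₀ ∧ 0 ≤ χ ∧ χ < 1 ∧ ∀ (L : ℝ) (ε : ENNReal)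 (R₀ : ℝ), 0 < L → 0 < ε → 𝒟.IsAdiabaticallyTracked N m₀ χ ε L R₀) → ∃ (e : AFEnd X) (F : EuclideanSpace ℝ (Fin 1) → InitialDataSet (𝓡 3) X), InitialDataSet.IsTameDataFamily e 1 F ∧ InitialDataSet.IsImmersedAtZero 1 F ∧ F 0 = D ∧ Function.Injective F ∧ (∀ c, F c ∈ admissibleVacuumData X) ∧ ∃ δ > (0 : ℝ), ∀ c, c ≠ 0 → ‖c‖ < δ → ∀ 𝒟 : VacuumCauchyDevelopment (F c), 𝒟.IsMaximal → Summit.FinalStateConjecture.HasCompleteNullInfinity 𝒟.toCauchyDevelopment ∧ ∃ (N : ℕ) (m₀ χ : ℝ), 0 < m₀ ∧ 0 ≤ χ ∧ χ < 1 ∧ ∀ (L : ℝ) (ε : ENNReal) (R₀ : ℝ), 0 < L → 0 < ε → 𝒟.IsAdiabaticallyTracked N m₀ χ ε L R₀ := by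
  sorry

/-! ## §3 The composition (kernel-checked; no `sorry` of its own) -/

/-- **THE CRUX BY NAME from the four registered stubs.** MGHD existence (S0) pointwise turns tame genericity of `Pure`
into tame genericity of `Good` (`IsTameChristodoulouGeneric.mono`); local genericity suffices
(`isTameChristodoulouGeneric_of_local`, the landed radial reparametrisation); through an exceptional datum: censored ⇒
S3; violating ⇒ S1 gives a locally censoring curve, `exists_tameCurve_of_local` globalises it, S2 lands it in the
tracked regime. [folklore] -/
theorem AdiabaticTracking_of :
    Goal.stub_mghdExists → Goal.stub_weakCosmicCensorship → Goal.stub_trackedLandingAlongCensoredCurves →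
      Goal.stub_trackingEscapeInsideCensored → AdiabaticTracking := by
  intro hM hW hL hT X _ _ _ _ _ _
  -- (1) S0, pointwise on the admissible class: pure ⟹ good
  have hPG : ∀ D ∈ admissibleVacuumData X, Pure D → Good D := fun D hD h ↦ ⟨hM X D hD, h⟩
  -- (2) hence tame genericity of the pure property suffices (monotonicity, same witness curves)
  suffices hgen : InitialDataSet.IsTameChristodoulouGeneric (admissibleVacuumData X) Pure 1 from
    hgen.mono hPG
  -- (3) and LOCAL witnesses suffice (radial reparametrisation of the parameter line)
  refine InitialDataSet.isTameChristodoulouGeneric_of_local fun d hd hbad ↦ ?_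
  by_cases hc : Censored d
  · -- (3a) censored but not pure: escape from the untracked walls inside the censored class (S3)
    exact hT X d hd hc hbad
  · -- (3b) violating: a locally censoring curve (S1) …
    have hV : ∃ 𝒟 : VacuumCauchyDevelopment d, 𝒟.IsMaximal ∧
        ¬ Summit.FinalStateConjecture.HasCompleteNullInfinity 𝒟.toCauchyDevelopment := by
      by_contra h
      apply hc
      intro 𝒟 h𝒟
      by_contra h'
      exact h ⟨𝒟, h𝒟, h'⟩
    obtain ⟨e, F, hF, himm, h0, hinj, hadm, ε, hε, hcens⟩ := hW X d hd hV
    -- … made censoring at every `c ≠ 0` (landed, TameGenericityLocal) …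
    obtain ⟨e₁, F₁, hF₁, h0₁, hinj₁, himm₁, hadm₁, hcens₁⟩ :=
      InitialDataSet.exists_tameCurve_of_local (P := Censored) hF h0 hinj himm hadm hε hcens
    -- … and landed in the tracked regime (S2); its base datum `F₁ 0 = d` is violating
    subst h0₁
    exact hL X e₁ F₁ hF₁ himm₁ hinj₁ hadm₁ hV hcens₁

/-- **The crux from the skeleton** (closed modulo the four `sorry`s: `AdiabaticTracking_of` applied to the registered
stubs — checks that each registered stub has exactly the `Goal` type). [folklore] -/
theorem AdiabaticTracking_proof : AdiabaticTracking :=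
  AdiabaticTracking_of stub_mghdExists stub_weakCosmicCensorship stub_trackedLandingAlongCensoredCurves
    stub_trackingEscapeInsideCensored

/-! ## §4 Sanity (no `sorry`): S0 is verbatim the route's support item; the crux implies S1, S2, S3 — they are
genuine weakenings, and S0 (a printed theorem, pointwise) is the only piece not implied by the crux -/

/-- S0 is, as an elaborated type, the route's shared support item `MGHDExists` (stmt-FinalStateConjecture-9937).
[folklore] -/
theorem mghdExists_iff : Goal.stub_mghdExists ↔ MGHDExists :=
  Iff.rfl

/-- The crux implies weak cosmic censorship in the tame local form (project `Good` to censorship along the crux's own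
witness curve; `ε = 1`). [folklore] -/
theorem weakCosmicCensorship_of_crux (h : AdiabaticTracking) : Goal.stub_weakCosmicCensorship := by
  intro X _ _ _ _ _ _ D hD hV
  have hexc : ¬ Good D := by
    rintro ⟨-, hP⟩
    obtain ⟨𝒟, h𝒟, hnc⟩ := hV
    exact hnc (hP 𝒟 h𝒟).1
  obtain ⟨e, F, hF, himm, h0, hinj, hadm, hE⟩ := h X D ⟨hD, hexc⟩
  have hgood : ∀ c, c ≠ 0 → Good (F c) := fun c hc ↦
    Classical.byContradiction fun hn ↦ hE c hc ⟨hadm c, hn⟩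
  exact ⟨e, F, hF, himm, h0, hinj, hadm, 1, one_pos, fun c hc _ 𝒟 h𝒟 ↦ ((hgood c hc).2 𝒟 h𝒟).1⟩

/-- The crux implies S2 (ignore the given censored curve: the violating base datum is exceptional for `Good`, and the
crux's own witness curve through it lands). [folklore] -/
theorem trackedLandingAlongCensoredCurves_of_crux (h : AdiabaticTracking) :
    Goal.stub_trackedLandingAlongCensoredCurves := by
  intro X _ _ _ _ _ _ e F hF himm hinj hadm hV hcens
  have hexc : ¬ Good (F 0) := by
    rintro ⟨-, hP⟩
    obtain ⟨𝒟, h𝒟, hnc⟩ := hV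
    exact hnc (hP 𝒟 h𝒟).1
  obtain ⟨e', F', hF', himm', h0', hinj', hadm', hE⟩ := h X (F 0) ⟨hadm 0, hexc⟩
  have hgood : ∀ c, c ≠ 0 → Good (F' c) := fun c hc ↦
    Classical.byContradiction fun hn ↦ hE c hc ⟨hadm' c, hn⟩
  exact ⟨e', F', hF', himm', h0', hinj', hadm', 1, one_pos, fun c hc _ ↦ (hgood c hc).2⟩

/-- The crux implies S3 (a censored datum with an untracked MGHD is exceptional for `Good`). [folklore] -/
theorem trackingEscapeInsideCensored_of_crux (h : AdiabaticTracking) :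
    Goal.stub_trackingEscapeInsideCensored := by
  intro X _ _ _ _ _ _ D hD _ hbad
  have hexc : ¬ Good D := fun hG ↦ hbad hG.2
  obtain ⟨e, F, hF, himm, h0, hinj, hadm, hE⟩ := h X D ⟨hD, hexc⟩
  have hgood : ∀ c, c ≠ 0 → Good (F c) := fun c hc ↦
    Classical.byContradiction fun hn ↦ hE c hc ⟨hadm c, hn⟩
  exact ⟨e, F, hF, himm, h0, hinj, hadm, 1, one_pos, fun c hc _ ↦ (hgood c hc).2⟩

end Summit.FinalStateConjecture.FinalStateConjecture.Cruxes.AdiabaticTracking.Birth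

end
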